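import Mathlib.NumberTheory.Padics.RingHoms
import Mathlib.GroupTheory.Torsion
import Mathlib.GroupTheory.Perm.Cycle.Type
import Mathlib.GroupTheory.Index
import Mathlib.Data.Int.LeastGreatest
import Mathlib.NumberTheory.Padics.PadicVal.Basic
import HarnessLib

/-!
# Class O1 (X5, `p = 2`): three group-theoretic lemmas for LEMMA ι (the Néron log index at `2`)

HONEST FRAMING (cell `b2b-bsdres`, run/shared/lean/b2b/bsd-rank1-residual/, verbatim in every
file): the goal of the cell is to DELETE the COMBINATION-SHAPED residual classes of the
Birch–Swinnerton-Dyer formula for ALL analytic-rank `≤ 1` elliptic curves over `ℚ` — "full BSD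
formula for every rank `≤ 1` curve in class `C`" assembled STRICTLY from published theorems — so
that the rank-`≤ 1` remainder becomes exactly the CONSTRUCTION-SHAPED classes, which are TYPED
(missing-input `Prop`s), NOT attempted. This is not "finishing BSD". THEOREMS ONLY (pure algebra;
nothing about any curve; nothing booked; no mark of RESIDUAL-MAP §I moves).

Unit `b2b-bsdres-cc-typer-4` (lane CLASS-CLOSURE, class O1), gen 5: the abstract inputs of the proof of
the re-typed LEMMA ι slot `O1.LocalLogDivIndexAtTwo` (`X5/TwoAdicLocalIndex.lean` §3; proof in
`X5/TwoAdicLocalIndexProof.lean`):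

* `exists_relIndex_eq_pow_of_ball_le` — **lattices in `ℚ_p`**: if an additive subgroup `S ≤ ℚ_p`
  contains the ball `B = {‖t‖ ≤ p⁻ⁿ}` with finite index `[S : B] ≠ 0`, then `[S : B] = pᵏ` for some
  `k`, every `s ∈ S` has `‖s‖ ≤ pᵏ·p⁻ⁿ`, and some `s ∈ S` attains it (i.e. `S = p⁻ᵏB`; the finite
  subgroups of `ℚ_p/ℤ_p` are the cyclic `p⁻ᵏℤ_p/ℤ_p`);
* `padicValNat_card_torsion_eq_primaryComponent` — for an additive commutative group with finite
  torsion subgroup `T`, `v_q(#T) = v_q(#T[q^∞])` (`[T : T[q^∞]]` is prime to `q`, by Cauchy);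
* `card_ker_mul_relIndex_map_eq_index` — for `f : G →+ Q` and `H ≤ G` with `H ⊓ ker f = ⊥`:
  `#ker f · [f(G) : f(H)] = [G : H]`.

References: J. H. Silverman, *AEC* 2nd ed. (2009), IV.6.4 (b), VII.6.3 (where these enter).
[SilvermanAEC2009]
-/

set_option autoImplicit false

noncomputable section

open scoped Classical

namespace Summit.BirchSwinnertonDyer.Rank1Residual.X5.O1

/-! ## §1 Lattices in `ℚ_p` squeezed above a ball -/

section Padic

variable {p : ℕ} [Fact p.Prime]

/-- In `ℚ_p`: a non-zero element has norm `p^j` for some `j ∈ ℤ`. [folklore] -/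
theorem exists_norm_eq_zpow {x : ℚ_[p]} (hx : x ≠ 0) : ∃ j : ℤ, ‖x‖ = (p : ℝ) ^ j :=
  ⟨-x.valuation, Padic.norm_eq_zpow_neg_valuation hx⟩

/-- **A subgroup of `ℚ_p` with bounded norms containing a non-zero element has an element of maximal
norm.** [folklore] -/
theorem exists_mem_norm_max {S : AddSubgroup ℚ_[p]} {C : ℝ} (hC : ∀ s ∈ S, ‖s‖ ≤ C) {s₁ : ℚ_[p]}
    (hs₁ : s₁ ∈ S) (hs₁0 : s₁ ≠ 0) :
    ∃ s₀ ∈ S, s₀ ≠ 0 ∧ ∀ s ∈ S, ‖s‖ ≤ ‖s₀‖ := by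
  have hp1 : (1 : ℝ) < p := by exact_mod_cast (Fact.out : p.Prime).one_lt
  obtain ⟨b, hb⟩ := pow_unbounded_of_one_lt C hp1
  have hbdd : ∃ b : ℤ, ∀ z : ℤ, (∃ s ∈ S, s ≠ 0 ∧ ‖s‖ = (p : ℝ) ^ z) → z ≤ b := by
    refine ⟨b, ?_⟩
    rintro z ⟨s, hs, -, hz⟩
    have h := (hC s hs).trans_lt hb
    rw [hz, ← zpow_natCast] at h
    exact ((zpow_lt_zpow_iff_right₀ hp1).mp h).le
  obtain ⟨j₀, ⟨s₀, hs₀, hs₀0, hj₀⟩, hmax⟩ := Int.exists_greatest_of_bdd hbdd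
    ⟨-s₁.valuation, s₁, hs₁, hs₁0, Padic.norm_eq_zpow_neg_valuation hs₁0⟩
  refine ⟨s₀, hs₀, hs₀0, fun s hs => ?_⟩
  by_cases h0 : s = 0
  · rw [h0, norm_zero]; exact norm_nonneg _
  · obtain ⟨j, hj⟩ := exists_norm_eq_zpow h0
    rw [hj, hj₀]
    exact zpow_le_zpow_right₀ hp1.le (hmax j ⟨s, hs, h0, hj⟩)

/-- **Lattices in `ℚ_p` above a ball.** Let `B ≤ S` be additive subgroups of `ℚ_p` with
`B = {t : ‖t‖ ≤ p⁻ⁿ}` and `[S : B] ≠ 0` (finite index). Then `[S : B] = pᵏ` for some `k : ℕ`, every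
`s ∈ S` has `‖s‖ ≤ pᵏ·p⁻ⁿ`, and some `s ∈ S` has `‖s‖ = pᵏ·p⁻ⁿ` — i.e. `S` is the ball of radius
`pᵏ⁻ⁿ` (the finite subgroups of `ℚ_p/p⁻ⁿℤ_p` are the balls). [folklore] -/
theorem exists_relIndex_eq_pow_of_ball_le {S B : AddSubgroup ℚ_[p]} {n : ℕ}
    (hB : ∀ t : ℚ_[p], t ∈ B ↔ ‖t‖ ≤ (p : ℝ) ^ (-(n : ℤ))) (hBS : B ≤ S) (hd : B.relIndex S ≠ 0) :
    ∃ k : ℕ, B.relIndex S = p ^ k ∧ (∀ s ∈ S, ‖s‖ ≤ (p : ℝ) ^ k * (p : ℝ) ^ (-(n : ℤ))) ∧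
      ∃ s ∈ S, ‖s‖ = (p : ℝ) ^ k * (p : ℝ) ^ (-(n : ℤ)) := by
  have hp : (p : ℕ).Prime := Fact.out
  have hp0 : (0 : ℝ) < p := by exact_mod_cast hp.pos
  have hp1 : (1 : ℝ) < p := by exact_mod_cast hp.one_lt
  set d : ℕ := B.relIndex S with hd_def
  -- (1) an a-priori bound: `d • s ∈ B` for `s ∈ S`
  have hdB : ∀ s ∈ S, ((d : ℕ) : ℚ_[p]) * s ∈ B := by
    intro s hs
    have h := AddSubgroup.nsmul_index_mem (B.addSubgroupOf S) ⟨s, hs⟩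
    rw [AddSubgroup.mem_addSubgroupOf, AddSubgroup.coe_nsmul] at h
    rw [← nsmul_eq_mul]
    exact h
  have hd0' : ((d : ℕ) : ℚ_[p]) ≠ 0 := Nat.cast_ne_zero.mpr hd
  have hbound : ∀ s ∈ S, ‖s‖ ≤ (p : ℝ) ^ (-(n : ℤ)) / ‖((d : ℕ) : ℚ_[p])‖ := by
    intro s hs
    rw [le_div_iff₀ (norm_pos_iff.mpr hd0'), mul_comm, ← norm_mul]
    exact (hB _).mp (hdB s hs)
  -- (2) the element `p^n ∈ B ⊆ S` of norm `p^{-n}`, and an element `s₀` of maximal norm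
  have hpn : ‖((p : ℚ_[p]) ^ n)‖ = (p : ℝ) ^ (-(n : ℤ)) := by
    rw [norm_pow, Padic.norm_p, inv_pow, ← zpow_natCast, zpow_neg]
  have hpnS : (p : ℚ_[p]) ^ n ∈ S := hBS ((hB _).mpr hpn.le)
  have hpn0 : (p : ℚ_[p]) ^ n ≠ 0 := pow_ne_zero _ (Nat.cast_ne_zero.mpr hp.ne_zero)
  obtain ⟨s₀, hs₀, hs₀0, hmax⟩ := exists_mem_norm_max hbound hpnS hpn0
  -- (3) `‖s₀‖ = p^k · p^{-n}` with `k : ℕ`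
  obtain ⟨j₀, hj₀⟩ := exists_norm_eq_zpow hs₀0
  have hjn : -(n : ℤ) ≤ j₀ := by
    have h := hmax _ hpnS
    rw [hpn, hj₀] at h
    exact (zpow_le_zpow_iff_right₀ hp1).mp h
  obtain ⟨k, hk⟩ : ∃ k : ℕ, j₀ = (k : ℤ) - n := ⟨(j₀ + n).toNat, by omega⟩
  have hnorm₀ : ‖s₀‖ = (p : ℝ) ^ k * (p : ℝ) ^ (-(n : ℤ)) := by
    rw [hj₀, hk, sub_eq_add_neg, zpow_add₀ hp0.ne', zpow_natCast]
  -- (4) `S = {‖t‖ ≤ ‖s₀‖}`: every such `t` is `a • s₀ + b` with `a ∈ ℕ`, `b ∈ B`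
  have hS : ∀ t : ℚ_[p], ‖t‖ ≤ ‖s₀‖ → t ∈ S := by
    intro t ht
    have hu : ‖t / s₀‖ ≤ 1 := by
      rw [norm_div, div_le_one (norm_pos_iff.mpr hs₀0)]; exact ht
    set x : ℤ_[p] := ⟨t / s₀, hu⟩ with hx
    have happr := PadicInt.appr_spec k x
    rw [← PadicInt.norm_le_pow_iff_mem_span_pow] at happr
    have hdecomp : t = ((x.appr k : ℕ) : ℚ_[p]) * s₀ + ((x : ℚ_[p]) - (x.appr k : ℕ)) * s₀ := by
      have : (x : ℚ_[p]) = t / s₀ := rfl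
      rw [this]; field_simp; ring
    rw [hdecomp]
    refine S.add_mem ?_ (hBS ((hB _).mpr ?_))
    · rw [← nsmul_eq_mul]; exact S.nsmul_mem hs₀ _
    · rw [norm_mul, hnorm₀]
      have hxa : ‖(x : ℚ_[p]) - ((x.appr k : ℕ) : ℚ_[p])‖ ≤ (p : ℝ) ^ (-(k : ℤ)) := by
        have h := happr
        rwa [PadicInt.norm_def, PadicInt.coe_sub, PadicInt.coe_natCast] at h
      calc ‖(x : ℚ_[p]) - ((x.appr k : ℕ) : ℚ_[p])‖ * ((p : ℝ) ^ k * (p : ℝ) ^ (-(n : ℤ)))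
          ≤ (p : ℝ) ^ (-(k : ℤ)) * ((p : ℝ) ^ k * (p : ℝ) ^ (-(n : ℤ))) :=
            mul_le_mul_of_nonneg_right hxa
              (mul_nonneg (pow_nonneg hp0.le _) (zpow_nonneg hp0.le _))
        _ = (p : ℝ) ^ (-(n : ℤ)) := by
            rw [← mul_assoc, ← zpow_natCast, ← zpow_add₀ hp0.ne', neg_add_cancel, zpow_zero,
              one_mul]
  -- (5) the index: `s ↦ (s/s₀ mod p^k)` is onto `ℤ/p^k` with kernel `B`
  have hmemS : ∀ s ∈ S, ‖s / s₀‖ ≤ 1 := by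
    intro s hs
    rw [norm_div, div_le_one (norm_pos_iff.mpr hs₀0)]; exact hmax s hs
  set ι : S → ℤ_[p] := fun s => ⟨(s : ℚ_[p]) / s₀, hmemS s s.2⟩ with hι
  have hιcoe : ∀ s : S, ((ι s : ℤ_[p]) : ℚ_[p]) = (s : ℚ_[p]) / s₀ := fun s => rfl
  have hιadd : ∀ a b : S, ι (a + b) = ι a + ι b := by
    intro a b
    apply PadicInt.ext
    rw [PadicInt.coe_add, hιcoe, hιcoe, hιcoe, AddSubgroup.coe_add, add_div]
  set φ : S →+ ZMod (p ^ k) := AddMonoidHom.mk' (fun s => PadicInt.toZModPow k (ι s))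
    (fun a b => by simp only [hιadd, map_add]) with hφ
  have hφapply : ∀ s : S, φ s = PadicInt.toZModPow k (ι s) := fun s => rfl
  have hφker : φ.ker = B.addSubgroupOf S := by
    ext s
    rw [AddMonoidHom.mem_ker, AddSubgroup.mem_addSubgroupOf, hB, hφapply, ← RingHom.mem_ker,
      PadicInt.ker_toZModPow, ← PadicInt.norm_le_pow_iff_mem_span_pow, PadicInt.norm_def, hιcoe,
      norm_div, div_le_iff₀ (norm_pos_iff.mpr hs₀0), hnorm₀, ← mul_assoc, ← zpow_natCast,
      ← zpow_add₀ hp0.ne', neg_add_cancel, zpow_zero, one_mul]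
  have hφsurj : Function.Surjective φ := by
    intro c
    have hmem : ((c.val : ℕ) : ℚ_[p]) * s₀ ∈ S := by
      rw [← nsmul_eq_mul]; exact S.nsmul_mem hs₀ _
    refine ⟨⟨((c.val : ℕ) : ℚ_[p]) * s₀, hmem⟩, ?_⟩
    have hval : ι ⟨((c.val : ℕ) : ℚ_[p]) * s₀, hmem⟩ = ((c.val : ℕ) : ℤ_[p]) := by
      apply PadicInt.ext
      rw [hιcoe, PadicInt.coe_natCast]
      exact mul_div_cancel_right₀ _ hs₀0
    rw [hφapply, hval, map_natCast, ZMod.natCast_zmod_val]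
  have hindex : B.relIndex S = p ^ k := by
    rw [AddSubgroup.relIndex, ← hφker, AddSubgroup.index_ker,
      AddMonoidHom.range_eq_top.mpr hφsurj, AddSubgroup.card_top, Nat.card_zmod]
  exact ⟨k, hindex, fun s hs => hnorm₀ ▸ hmax s hs, s₀, hs₀, hnorm₀⟩

end Padic

/-! ## §2 The `q`-part of a finite torsion subgroup is its `q`-primary component -/

section Torsion

variable {G : Type*} [AddCommGroup G] (q : ℕ) [hq : Fact q.Prime]

/-- The `q`-primary component lies in the torsion subgroup. [folklore] -/
theorem primaryComponent_le_torsion : AddCommGroup.primaryComponent G q ≤ AddCommGroup.torsion G := by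
  intro g hg
  obtain ⟨n, hn⟩ := (AddCommGroup.mem_primaryComponent (G := G) (p := q)).mp hg
  rw [AddCommGroup.mem_torsion]
  exact isOfFinAddOrder_iff_nsmul_eq_zero.mpr ⟨q ^ n, pow_pos hq.out.pos n, hn⟩

/-- **`v_q(#T) = v_q(#T[q^∞])`** for the (finite) torsion subgroup `T` of an additive commutative
group: the index `[T : T[q^∞]]` is prime to `q` (Cauchy's theorem in `T/T[q^∞]`). [folklore] -/
theorem padicValNat_card_torsion_eq_primaryComponent [Finite (AddCommGroup.torsion G)] :
    padicValNat q (Nat.card (AddCommGroup.torsion G)) =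
      padicValNat q (Nat.card (AddCommGroup.primaryComponent G q)) := by
  set T := AddCommGroup.torsion G with hT
  set P : AddSubgroup T := (AddCommGroup.primaryComponent G q).addSubgroupOf T with hP
  have hcardP : Nat.card P = Nat.card (AddCommGroup.primaryComponent G q) :=
    Nat.card_congr (AddSubgroup.addSubgroupOfEquivOfLe (primaryComponent_le_torsion q)).toEquiv
  have hmul : Nat.card P * P.index = Nat.card T := AddSubgroup.card_mul_index P
  have hP0 : Nat.card P ≠ 0 := Nat.card_pos.ne'
  have hI0 : P.index ≠ 0 := AddSubgroup.index_ne_zero_of_finite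
  -- `q ∤ [T : P]`
  have hndvd : ¬ q ∣ P.index := by
    intro hdvd
    letI : Fintype (T ⧸ P) := Fintype.ofFinite _
    rw [AddSubgroup.index, Nat.card_eq_fintype_card] at hdvd
    obtain ⟨y, hy⟩ := exists_prime_addOrderOf_dvd_card q hdvd
    obtain ⟨x, rfl⟩ := QuotientAddGroup.mk_surjective y
    -- `q • x ∈ P`, so `x` has `q`-power order, so `x ∈ P`, so `y = 0`
    have h1 : q • (QuotientAddGroup.mk x : T ⧸ P) = 0 := by
      have h := addOrderOf_nsmul_eq_zero (QuotientAddGroup.mk x : T ⧸ P)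
      rwa [hy] at h
    have hqx : q • x ∈ P := by
      rw [← QuotientAddGroup.eq_zero_iff, QuotientAddGroup.mk_nsmul]; exact h1
    rw [hP, AddSubgroup.mem_addSubgroupOf, AddCommGroup.mem_primaryComponent] at hqx
    obtain ⟨a, ha⟩ := hqx
    have hx : ((x : T) : G) ∈ AddCommGroup.primaryComponent G q := by
      rw [AddCommGroup.mem_primaryComponent]
      refine ⟨a + 1, ?_⟩
      rw [pow_succ, mul_nsmul', ← AddSubgroup.coe_nsmul]
      exact ha
    have hx' : x ∈ P := by rw [hP, AddSubgroup.mem_addSubgroupOf]; exact hx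
    have h0 : (QuotientAddGroup.mk x : T ⧸ P) = 0 := (QuotientAddGroup.eq_zero_iff x).mpr hx'
    rw [h0, addOrderOf_zero] at hy
    exact hq.out.one_lt.ne' hy.symm
  rw [← hmul, padicValNat.mul hP0 hI0, padicValNat.eq_zero_of_not_dvd hndvd, add_zero, hcardP]

end Torsion

/-! ## §3 `#ker f · [f(G) : f(H)] = [G : H]` when `H ∩ ker f = 0` -/

section Index

variable {G Q : Type*} [AddCommGroup G] [AddCommGroup Q]

/-- For `f : G →+ Q` and `H ≤ G` meeting `ker f` trivially: `#ker f · [f(G) : f(H)] = [G : H]`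
(`[G : H] = [G : H + ker f]·[H + ker f : H]`, `[H + ker f : H] = #ker f`,
`[G : H + ker f] = [f(G) : f(H)]`). [folklore] -/
theorem card_ker_mul_relIndex_map_eq_index (f : G →+ Q) (H : AddSubgroup G) (hH : H ⊓ f.ker = ⊥) :
    Nat.card f.ker * (H.map f).relIndex f.range = H.index := by
  have h1 : H.relIndex (H ⊔ f.ker) * (H ⊔ f.ker).index = H.index :=
    AddSubgroup.relIndex_mul_index le_sup_left
  have h2 : H.relIndex (H ⊔ f.ker) = Nat.card f.ker := by
    rw [AddSubgroup.relIndex_sup_left, ← AddSubgroup.inf_relIndex_right, hH,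
      AddSubgroup.relIndex_bot_left]
  have h3 : (H ⊔ f.ker).index = (H.map f).relIndex f.range := by
    rw [← AddSubgroup.comap_map_eq, AddSubgroup.index_comap]
  rw [← h1, h2, h3]

end Index

end Summit.BirchSwinnertonDyer.Rank1Residual.X5.O1

end
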